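import Summits.BirchSwinnertonDyer.BirchSwinnertonDyer.Theorems.ErratumRoadFiveShimuraKolyvaginOrderBoundInertShiftMachine
import Summits.BirchSwinnertonDyer.BirchSwinnertonDyer.Theorems.ErratumRoadFiveShimuraKolyvaginOrderBoundInertReciprocity
import Summits.BirchSwinnertonDyer.BirchSwinnertonDyer.Theorems.ClassRecordThreeShimuraKolyvaginOrderBoundAtThreeSurjLocalShift
import HarnessLib

/-!
# Route `ErratumRoadFive`, crux `ShimuraKolyvaginOrderBoundInertFromFive` (item
# stmt-BirchSwinnertonDyer-19718) — the MACHINE half of the level shift, IV: the END on the locus of item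
# 19718 WITHOUT the Tamagawa clause — S1's shape from the depth-`k` ring-class-rational carrier and Poitou–Tate

Cell `bsd-stepL`, seat `bsd-stepL-shim-p1` (prover g8), HELPER for the crux
`Summit.BirchSwinnertonDyer.BirchSwinnertonDyer.Theses.ErratumRoadFive.ShimuraKolyvaginOrderBoundInertFromFive`
(`--supports stmt-BirchSwinnertonDyer-19718 --as helper`; K2 route `route-BirchSwinnertonDyer-ErratumRoadFive`
rev 19; skeleton v2 df9d5864b1b31f6b, stub S1 `stub_inert_unitIndex`). Sequel of `…InertShiftCebotarev` ∕
`…InertShiftDescent` ∕ `…InertShiftMachine` (the machine at Kolyvagin primes of depth `M + k`), of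
`…InertMachineEntry` §4 ∕ `…InertReciprocity` §3 (g7: the END WITH the clause `hTam` of option (ii)), and of
shim3a's `ClassRecordThreeShimuraKolyvaginOrderBoundAtThreeSurjLocalShift` §6 (the LOCAL level-shift lemma,
`p`-generic). Planner rulings g27 21:38Z ∕ g28 00:20:29Z: 19718 ∕ S1 ∕ S2 stay as typed; S1's road is the
LEVEL SHIFT; the `hTam` re-key is declined. THIS FILE REMOVES `hTam` from the kernel's S1 shape.

## What is proved (theorems only; no `def`, no named fact, no `sorry`)

* §1 `padicValNat_ordMinimalDiscriminant_le_of_split` — on the crux's locus (`hsp`: every bad prime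
  `ℓ ∉ S` splits in `K`) the `p`-part of the Kodaira–Néron exponent `ord_w Δ_min(E/K)` at a
  multiplicative place `w` over `ℓ ∉ S` is bounded by the ℚ-side constant
  `k₀(E, p) = 1 + Σ_{ℓ ∣ N} v_p(ord_ℓ Δ_min(E/ℚ))` (transport A233 of `…InertLocalAll` §3).
* §2 **`sha_primary_eq_zero_of_ringClassRationalPointsM_shift`** — `Ш(E/K)[p^∞] = 0` on the locus of
  item 19718 (binders `hN`, `5 ≤ p`, `ρ̄` onto, `K` imaginary quadratic, `hin`, `hsp` VERBATIM; NO `hTam`)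
  from `P ∉ pE(K)`, Kolyvagin reciprocity (R)_M, and the RING-CLASS-RATIONAL carrier read at DEPTH `k`:
  `hpointsRk` = the `hpointsR` binder of `…InertMachineEntry` §4 asked for every depth `k`, its per-level
  clauses required only at the square-free products of Kolyvagin primes with `Frob = Frob(∞)` on
  `E[p^{M+k}]`, plus the two deep clauses the supplier has for free there (`A_m` has no `p`-power torsion
  at all; `P_m` is invariant modulo `p^{M+k}` because `a_ℓ ≡ ℓ + 1 ≡ 0 mod p^{M+k}`). The Selmer clause
  (d) at EVERY `v ∤ m` is then shim3a's level-shift lemma with `k = k₀(E, p)` (§1), and the machine is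
  file III's `sha_primary_eq_zero_at_of_pointsM_shift_of_reciprocityM_of_not_dvd_of_conductorNorm`.
* §3 **`natCard_primaryComponent_sha_le_of_ringClassRationalPointsM_shift_of_poitouTate`** — S1's
  CONCLUSION `Nat.card Ш(E/K)[p^∞] ≤ p^{2·ord_p[E(K):ℤP]}` on the crux's binders + `0 < index`, from
  `hpointsRk` and the Poitou–Tate named fact `hPT` (conjunct 14 of `PublishedInputsFive`) — the g7 theorem
  `natCard_primaryComponent_sha_le_of_ringClassRationalPointsM_of_poitouTate` (p471634) WITH `hTam` DELETED.

HONEST FRAMING: S1 `stub_inert_unitIndex` and item 19718 stay OPEN. After this file the gap between the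
kernel and S1 AS REGISTERED is exactly: (α) the Shimura Euler-system CARRIER `hpointsRk` (CM points of
conductor `m` on `X_{N⁺,N⁻}` rational over `K[m]`, trace ∕ congruence ∕ complex-conjugation relations —
PRINTED: Bertolini–Darmon 1996 §2.3–2.6 + Prop. 2.6, Nekovář 2007 (4.8)(4.9)(4.13); assembly = x11b3's
pipeline, bricks p475855 ∕ p476190), (β) Poitou–Tate `hPT` (∈ `PublishedInputsFive`), (δ) the guard
`0 < [E(K):ℤP]` (finiteness of the index: printed, supplier-carried per planner g28). The Tamagawa clause
`hTam` of g7's END is GONE. BSD is not proved by any of this; no census number moves.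
[cite: McCallumLMS1991, §1 Theorem (Kolyvagin), §4 Lemma 4.3, Lemma 4.6, §5 Lemma 5.1] [cite: GrossLMS1991,
Prop. 2.1 (2), Prop. 6.2 (1), §10] [cite: Howard2004Duke, Thm. 3.2.2 (proof), Lemma 3.3.5]
[cite: SilvermanAEC2009, Thm. VII.6.1, Prop. VII.5.4 (a)] [cite: MilneADT2006, Ch. I Prop. 3.8, Thm. 4.10(b)]
[cite: BertoliniDarmon1996, §2.3–2.6, Prop. 2.6] [cite: Kim2022HigherGZ, §2.1 and Thm. 4.3]
presearch: as files I–III and HOME/shim/SHIM3A-MEMO-19616.md §1 (referee g34 PASS; corpus + galaxy);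
`lean search 'ringClassRationalPointsM_shift'` → none.
-/

noncomputable section

open scoped Classical Pointwise AddSubgroup

set_option linter.dupNamespace false

namespace Summit.BirchSwinnertonDyer.BirchSwinnertonDyer.Theorems

open WeierstrassCurve NumberField IsDedekindDomain Field Function
  Literature.NumberTheory.EllipticCurves Literature.NumberTheory.EllipticCurves.KolyvaginCocycle
  Literature.NumberTheory.EllipticCurves.RingClassField
  Literature.NumberTheory.GaloisRepresentations Literature.NumberTheory.NumberFields
  Literature.NumberTheory.GaloisCohomology
  Summit.BirchSwinnertonDyer.Rank1Residual.X11b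
  Summit.BirchSwinnertonDyer.BirchSwinnertonDyer.Theorems.ShimuraKolyvaginLocalShift

variable {K : Type} [Field K] [NumberField K]

/-! ### §1 The ℚ-side bound for the `p`-part of the Kodaira–Néron exponents on the crux's locus -/

/-- **`v_p(ord_w Δ_min(E/K)) ≤ 1 + Σ_{ℓ ∣ N} v_p(ord_ℓ Δ_min(E/ℚ))` at every multiplicative place `w` of
`E/K` over a prime `ℓ ∉ S`.** On the locus of item 19718 every bad prime `ℓ ∉ S` splits in `K` (`hsp`), so
`w | ℓ` is unramified and `ord_w Δ_min(E/K) = ord_ℓ Δ_min(E/ℚ)` (A233, `…InertLocalAll` §3); `ℓ ∣ N`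
because the conductor detects bad reduction. Hence the depth `k₀ = 1 + Σ_{ℓ ∣ N} v_p(ord_ℓ Δ_min(E/ℚ))`
serves as the `k` of shim3a's level-shift lemma uniformly in `w`. [cite: SilvermanAEC2009, Prop. VII.5.4 (a),
Thm. VII.6.1] -/
theorem padicValNat_ordMinimalDiscriminant_le_of_split
    (hK : IsImaginaryQuadratic K) (W : WeierstrassCurve ℚ) [W.IsElliptic] [W.IsGloballyMinimal]
    {N : ℕ} [NeZero N] (hN : W.conductorNorm ℤ = N) (p : ℕ) {S : Finset ℕ}
    (hsp : ∀ ℓ : ℕ, ℓ.Prime → ℓ ∣ N → ℓ ∉ S → ((Ideal.span {(ℓ : ℤ)}).primesOver (𝓞 K)).ncard = 2)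
    (w : HeightOneSpectrum (𝓞 K)) (hmw : (W.baseChange K).HasMultiplicativeReductionAt w)
    (hℓS : ((Rat.HeightOneSpectrum.primesEquiv (w.under (𝓞 ℚ)) : ℕ)) ∉ S) :
    padicValNat p ((W.baseChange K).ordMinimalDiscriminant w) ≤
      1 + ∑ q ∈ N.primeFactors, padicValNat p (padicValInt q W.minimalDiscriminantInt) := by
  haveI : (W.baseChange K).IsElliptic := inferInstanceAs (W.map (algebraMap ℚ K)).IsElliptic
  obtain ⟨-, hord, hbadv⟩ := kodairaSymbolAt_and_ordMinimalDiscriminant_baseChange_eq_of_split hK W hN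
    hsp w hmw.not_hasGoodReductionAt hℓS
  rw [hord]
  set ℓ : ℕ := (Rat.HeightOneSpectrum.primesEquiv (w.under (𝓞 ℚ)) : ℕ) with hℓdef
  have hℓP : ℓ.Prime := (Rat.HeightOneSpectrum.primesEquiv (w.under (𝓞 ℚ))).2
  have hℓN : ℓ ∣ N := by rw [← hN]; exact (W.dvd_conductorNorm_iff (w.under (𝓞 ℚ))).mpr hbadv
  have hmem : ℓ ∈ N.primeFactors := Nat.mem_primeFactors.mpr ⟨hℓP, hℓN, NeZero.ne N⟩
  have hle : padicValNat p (padicValInt ℓ W.minimalDiscriminantInt) ≤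
      ∑ q ∈ N.primeFactors, padicValNat p (padicValInt q W.minimalDiscriminantInt) :=
    Finset.single_le_sum (f := fun q ↦ padicValNat p (padicValInt q W.minimalDiscriminantInt))
      (fun _ _ ↦ Nat.zero_le _) hmem
  omega

/-! ### §2 `Ш(E/K)[p^∞] = 0` on the locus of item 19718 from the depth-`k` ring-class-rational carrier — NO `hTam` -/

/-- **`Ш(E/K)[p^∞] = 0` on the locus of item 19718 from `P ∉ pE(K)`, the RING-CLASS-RATIONAL Euler-system
carrier read at depth `k`, and Kolyvagin reciprocity — with NO Tamagawa clause.** Binders: the crux's `W`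
(globally minimal, conductor `N`), `p ≥ 5` with `ρ̄_{E,p}` onto, `K` imaginary quadratic with `ι : K → ℂ`,
the inert set `S` with the crux's clauses `hin` ∕ `hsp` VERBATIM; a non-torsion `P ∈ E(K)` with `p ∤ P` in
`E(K)`; `hpointsRk` — for EVERY depth `k` and every `M ≥ 1`: a sign `ε`, a lift `τ` of `c`, modules
`A_m ≤ E(K̄)` admissible for `p^M` AND for `p^{M+k}` (printed: `A_m = E(K[m])`, no `p`-torsion at all,
Gross Lemma 4.3), `K`-embeddings `emb m : K[m] → K̄` with every point of `A_m` rational over `emb m (K[m])`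
(Gross (4.1), BD96 §2.3–2.5), points `P_m ∈ A_m` invariant modulo `p^M` with `P_1 = P`, and, for the
square-free products `m` of Kolyvagin primes with `Frob = Frob(∞)` on `E[p^{M+k}]`: `P_m` invariant modulo
`p^{M+k}` (McCallum (4) at depth `M + k`: `a_ℓ ≡ ℓ + 1 ≡ 0 mod p^{M+k}`), Gross 5.4 (1) (eigen relation
modulo `p^M A_m`) and McCallum 4.4 at `λ ∣ m` for the LEVEL-`p^M` classes; plus (R)_M `hR` at the level-`M`
Kolyvagin primes. Conclusion: every element of `Ш(E/K)` killed by a power of `p` is `0`. Proof: file III's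
`sha_primary_eq_zero_at_of_pointsM_shift_of_reciprocityM_of_not_dvd_of_conductorNorm` at the depth
`k₀ = 1 + Σ_{ℓ ∣ N} v_p(ord_ℓ Δ_min(E/ℚ))`, the Selmer clause (d) at EVERY `v ∤ m` being shim3a's LEVEL-SHIFT
lemma `ShimuraKolyvaginLocalShift.kolyvaginClass_mem_selmerLocalKer_of_ringClassRational_shift` with §1.
Compared with `…InertMachineEntry` §4 (`sha_primary_eq_zero_of_ringClassRationalPointsM`, g7): the clause
`hTam` is DELETED, the carrier is read one notch deeper. HONEST: this is S1 of the skeleton MODULO (a) the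
Shimura Euler-system carrier in this currency (BD96 §2, Nekovář 2007 (4.8)–(4.13) — printed, not in the
tree), (b) (R)_M (from Poitou–Tate, `…InertReciprocity` §1), (c) the index guard of the `Nat.card` form
below; item 19718 and S1 ∕ S2 stay OPEN. [cite: GrossLMS1991, §1 Thm. 1.3 (2), Prop. 2.1 (2), §§3–8, §10]
[cite: McCallumLMS1991, §1, §§4–5, Lemma 4.6] [cite: BertoliniDarmon1996, §2.3–2.6, Prop. 2.6]
[cite: Howard2004Duke, Thm. 3.2.2 (proof)] [cite: Kim2022HigherGZ, §2.1 and Thm. 4.3] -/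
theorem sha_primary_eq_zero_of_ringClassRationalPointsM_shift
    (W : WeierstrassCurve ℚ) [W.IsElliptic] [W.IsGloballyMinimal] {N : ℕ} [NeZero N]
    (hN : W.conductorNorm ℤ = N) {p : ℕ} (hp : p.Prime) (hp5 : 5 ≤ p)
    (hρ : W.HasSurjectiveModNGaloisRep p) (hK : IsImaginaryQuadratic K) (ι : K →+* ℂ)
    {S : Finset ℕ}
    (hin : ∀ ℓ ∈ S, ℓ.Prime ∧ ℓ ∣ N ∧ ¬ ℓ ^ 2 ∣ N ∧
      ((Ideal.span {(ℓ : ℤ)}).primesOver (𝓞 K)).ncard = 1 ∧ ¬ (ℓ : ℤ) ∣ NumberField.discr K)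
    (hsp : ∀ ℓ : ℕ, ℓ.Prime → ℓ ∣ N → ℓ ∉ S → ((Ideal.span {(ℓ : ℤ)}).primesOver (𝓞 K)).ncard = 2)
    {P : (W.baseChange K).toAffine.Point} (hnt : ¬ IsOfFinAddOrder P)
    (hndvd : ∀ Q : (W.baseChange K).toAffine.Point, p • Q ≠ P)
    (hpointsRk : ∀ (k : ℕ) {M : ℕ} (_hM : 1 ≤ M)
      (hdiv : ∀ Q : geomPoints (W.baseChange K), ∃ R, ((p ^ M : ℕ) : ℤ) • R = Q)
      (c : K ≃ₐ[ℚ] K) (_hc : c ≠ 1),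
      ∃ (ε : ℤ) (τ : AlgebraicClosure K ≃+* AlgebraicClosure K) (hτ : IsLiftOfAut c τ)
        (A : ℕ → AddSubgroup (geomPoints (W.baseChange K)))
        (hA : ∀ m, KolyvaginCocycle.IsAdmissible (Field.absoluteGaloisGroup K) (A m)
          ((p ^ M : ℕ) : ℤ))
        (emb : ∀ m : ℕ, ringClassField K ι m →ₐ[K] AlgebraicClosure K)
        (Pt : ℕ → geomPoints (W.baseChange K))
        (hPt : ∀ m, Pt m ∈
          KolyvaginCocycle.invPoints (Field.absoluteGaloisGroup K) (A m) ((p ^ M : ℕ) : ℤ)),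
        (ε = 1 ∨ ε = -1) ∧
        IsOfFinAddOrder (Affine.Point.map (W' := W) (c : K →ₐ[ℚ] K) P - ε • P) ∧
        (∀ m, ∀ a ∈ A m, hτ.pointsMap W a ∈ A m) ∧
        Pt 1 = toGeomPoints (W.baseChange K) P ∧
        (∀ m, m ≠ 0 → ∀ a ∈ A m, ∀ Φ : Field.absoluteGaloisGroup K,
          (∀ x : ringClassField K ι m, Φ • emb m x = emb m x) → Φ • a = a) ∧
        (∀ m, KolyvaginCocycle.IsAdmissible (Field.absoluteGaloisGroup K) (A m)
          ((p ^ (M + k) : ℕ) : ℤ)) ∧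
        (∀ m : ℕ, Squarefree m →
          (∀ q ∈ m.primeFactors, IsKolyvaginPrime N W K p q ∧ FrobEqFrobInfty W K (p ^ (M + k)) q) →
          Pt m ∈ KolyvaginCocycle.invPoints (Field.absoluteGaloisGroup K) (A m)
            ((p ^ (M + k) : ℕ) : ℤ) ∧
          (∃ B ∈ A m, hτ.pointsMap W (Pt m) =
            (ε * (-1) ^ m.primeFactors.card) • Pt m + ((p ^ M : ℕ) : ℤ) • B) ∧
          (∀ ℓ : ℕ, ℓ.Prime → ℓ ∣ m → ∀ v : HeightOneSpectrum (𝓞 K), (ℓ : 𝓞 K) ∈ v.asIdeal →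
            ∀ a : ℕ, (((p : ℤ) ^ a) •
                kolyvaginClass (W.baseChange K) _ hdiv (hA m) (Pt m) (hPt m) ∈
                selmerLocalKer (W.baseChange K) (v.adicCompletion K) ((p ^ M : ℕ) : ℤ) ↔
              ((p : ℤ) ^ a) • kolyvaginClass (W.baseChange K) _ hdiv (hA (m / ℓ)) (Pt (m / ℓ))
                  (hPt (m / ℓ)) ∈
                (W.baseChange K).torsionLocalKer (v.adicCompletion K) ((p ^ M : ℕ) : ℤ)))))
    (hR : ∀ {M : ℕ} (_hM : 1 ≤ M) {ℓ : ℕ} (hℓ : IsKolyvaginPrime N W K p ℓ),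
      FrobEqFrobInfty W K (p ^ M) ℓ →
      ∃ (A : Type) (_ : AddCommGroup A)
        (e : geomTorsion (W.baseChange K) ((p ^ M : ℕ) : ℤ) →+
          geomTorsion (W.baseChange K) ((p ^ M : ℕ) : ℤ) →+ A),
        (∀ x, e x x = 0) ∧ (∀ x, (∀ y, e x y = 0) → x = 0) ∧
        ∀ s ∈ selmerGroup (W.baseChange K) ((p ^ M : ℕ) : ℤ),
          ∀ c' : galH1Torsion (W.baseChange K) ((p ^ M : ℕ) : ℤ),
          (∀ v : HeightOneSpectrum (𝓞 K), (ℓ : 𝓞 K) ∉ v.asIdeal →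
            c' ∈ selmerLocalKer (W.baseChange K) (v.adicCompletion K) ((p ^ M : ℕ) : ℤ)) →
          (∀ w : InfinitePlace K,
            c' ∈ selmerLocalKer (W.baseChange K) w.Completion ((p ^ M : ℕ) : ℤ)) →
          ∀ 𝔔 ∈ hℓ.place.primesAbove, ∀ F : Field.absoluteGaloisGroup K,
            IsArithFrobAt (𝓞 K) F 𝔔 →
            F ∈ torsionFixing (W.baseChange K) ((p ^ M : ℕ) : ℤ) →
            ∀ σ ∈ 𝔔.inertia (Field.absoluteGaloisGroup K),
            e (h1Eval (W.baseChange K) ((p ^ M : ℕ) : ℤ) s F)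
              (h1Eval (W.baseChange K) ((p ^ M : ℕ) : ℤ) c' σ) = 0) :
    ∀ d : (W.baseChange K).sha, (∃ j : ℕ, p ^ j • d = 0) → d = 0 := by
  haveI : (W.baseChange K).IsElliptic := inferInstanceAs (W.map (algebraMap ℚ K)).IsElliptic
  have hp2 : p ≠ 2 := by omega
  -- the depth `k₀` absorbing the `p`-parts of all Kodaira–Néron exponents on the locus
  set k₀ : ℕ := 1 + ∑ q ∈ N.primeFactors, padicValNat p (padicValInt q W.minimalDiscriminantInt) with hk₀
  have hk1 : 1 ≤ k₀ := Nat.le_add_right 1 _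
  have hkm : ∀ w : HeightOneSpectrum (𝓞 K), (W.baseChange K).HasMultiplicativeReductionAt w →
      ((Rat.HeightOneSpectrum.primesEquiv (w.under (𝓞 ℚ)) : ℕ)) ∉ S →
      padicValNat p ((W.baseChange K).ordMinimalDiscriminant w) ≤ k₀ := fun w hmw hℓS ↦
    padicValNat_ordMinimalDiscriminant_le_of_split hK W hN p hsp w hmw hℓS
  refine sha_primary_eq_zero_at_of_pointsM_shift_of_reciprocityM_of_not_dvd_of_conductorNorm W hN hK hnt
    hp hp2 hρ k₀ hndvd ?_ hR
  intro M hM hdiv c hc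
  obtain ⟨ε, τ, hτ, A, hA, emb, Pt, hPt, hε, h53, hAτ, hPt1, hrat, hAk, hm'⟩ := hpointsRk k₀ hM hdiv c hc
  refine ⟨ε, τ, hτ, A, hA, Pt, hPt, hε, h53, hAτ, hPt1, fun m hm hk ↦
    ⟨(hm' m hm hk).2.1, ?_, (hm' m hm hk).2.2⟩⟩
  intro v hv
  have hm0 : m ≠ 0 := Squarefree.ne_zero hm
  exact kolyvaginClass_mem_selmerLocalKer_of_ringClassRational_shift hK ι hm0 (emb m) W hp hp2 hin hk1
    hkm (fun q hq ↦ (hk q hq).1.2.1) (hA m) (hAk m) (hrat m hm0) (hPt m) ((hm' m hm hk).1) v hv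

/-! ### §3 S1's `Nat.card` shape on the locus of item 19718, modulo the depth-`k` carrier and Poitou–Tate — NO `hTam` -/

/-- **S1's conclusion `#Ш(E/K)[p^∞] ≤ p^{2·ord_p[E(K):ℤP]}` (here `= 1`) on the locus of item 19718, from
the depth-`k` ring-class-rational Euler-system data and the Poitou–Tate named fact — WITHOUT the Tamagawa
clause.** Binders: the crux's (`W` globally minimal of conductor `N`, `[Fact p.Prime]`, `5 ≤ p`, `ρ̄_{E,p}`
onto, `K` imaginary quadratic, `hin`, `hsp`) + `ι : K → ℂ` + `P ∈ E(K)` non-torsion with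
`padicValNat p [E(K):ℤP] = 0` AND the guard `0 < [E(K):ℤP]` + `hpointsRk` (§2) + `hPT` (Poitou–Tate,
cite-only named fact, conjunct 14 of `PublishedInputsFive` ⇒ this theorem is CONDITIONAL on it). Proof:
(R)_M from `kolyvaginReciprocityM_of_poitouTate_of_conductorNorm` (p471634 §1), `P ∉ pE(K)` from
`nsmul_ne_of_padicValNat_index_eq_zero` (p471634 §2), `Ш(E/K)[p^∞] = 0` from §2; the `p`-primary component
is `⊥`. This is g7's `natCard_primaryComponent_sha_le_of_ringClassRationalPointsM_of_poitouTate` with the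
hypothesis `hTam` DELETED (planner g28: the level shift makes the Tamagawa clause dead weight). HONEST: S1
stays OPEN — the gap to its registered signature is now exactly {`hpointsRk` (printed carrier, read one
notch deeper), `hPT`, `0 < index`}; S1's data `Dt X W' P₀ degS` + GZ display are not used.
[cite: GrossLMS1991, Prop. 2.1 (2)] [cite: McCallumLMS1991, §1 Theorem (Kolyvagin), Lemma 4.6, Lemma 5.1]
[cite: MilneADT2006, Ch. I Thm. 4.10(b)] [cite: Howard2004Duke, Thm. 3.2.2 (proof)] -/
theorem natCard_primaryComponent_sha_le_of_ringClassRationalPointsM_shift_of_poitouTate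
    (hPT : poitouTate_sum_localTatePairing_eq_zero K)
    (W : WeierstrassCurve ℚ) [W.IsElliptic] [W.IsGloballyMinimal] {N : ℕ} [NeZero N]
    (hN : W.conductorNorm ℤ = N) {p : ℕ} [Fact p.Prime] (hp5 : 5 ≤ p)
    (hρ : W.HasSurjectiveModNGaloisRep p) (hK : IsImaginaryQuadratic K) (ι : K →+* ℂ)
    {S : Finset ℕ}
    (hin : ∀ ℓ ∈ S, ℓ.Prime ∧ ℓ ∣ N ∧ ¬ ℓ ^ 2 ∣ N ∧
      ((Ideal.span {(ℓ : ℤ)}).primesOver (𝓞 K)).ncard = 1 ∧ ¬ (ℓ : ℤ) ∣ NumberField.discr K)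
    (hsp : ∀ ℓ : ℕ, ℓ.Prime → ℓ ∣ N → ℓ ∉ S → ((Ideal.span {(ℓ : ℤ)}).primesOver (𝓞 K)).ncard = 2)
    {P : (W.baseChange K).toAffine.Point} (hnt : ¬ IsOfFinAddOrder P)
    (hidx0 : 0 < (AddSubgroup.zmultiples P).index)
    (hidx : padicValNat p (AddSubgroup.zmultiples P).index = 0)
    (hpointsRk : ∀ (k : ℕ) {M : ℕ} (_hM : 1 ≤ M)
      (hdiv : ∀ Q : geomPoints (W.baseChange K), ∃ R, ((p ^ M : ℕ) : ℤ) • R = Q)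
      (c : K ≃ₐ[ℚ] K) (_hc : c ≠ 1),
      ∃ (ε : ℤ) (τ : AlgebraicClosure K ≃+* AlgebraicClosure K) (hτ : IsLiftOfAut c τ)
        (A : ℕ → AddSubgroup (geomPoints (W.baseChange K)))
        (hA : ∀ m, KolyvaginCocycle.IsAdmissible (Field.absoluteGaloisGroup K) (A m)
          ((p ^ M : ℕ) : ℤ))
        (emb : ∀ m : ℕ, ringClassField K ι m →ₐ[K] AlgebraicClosure K)
        (Pt : ℕ → geomPoints (W.baseChange K))
        (hPt : ∀ m, Pt m ∈
          KolyvaginCocycle.invPoints (Field.absoluteGaloisGroup K) (A m) ((p ^ M : ℕ) : ℤ)),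
        (ε = 1 ∨ ε = -1) ∧
        IsOfFinAddOrder (Affine.Point.map (W' := W) (c : K →ₐ[ℚ] K) P - ε • P) ∧
        (∀ m, ∀ a ∈ A m, hτ.pointsMap W a ∈ A m) ∧
        Pt 1 = toGeomPoints (W.baseChange K) P ∧
        (∀ m, m ≠ 0 → ∀ a ∈ A m, ∀ Φ : Field.absoluteGaloisGroup K,
          (∀ x : ringClassField K ι m, Φ • emb m x = emb m x) → Φ • a = a) ∧
        (∀ m, KolyvaginCocycle.IsAdmissible (Field.absoluteGaloisGroup K) (A m)
          ((p ^ (M + k) : ℕ) : ℤ)) ∧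
        (∀ m : ℕ, Squarefree m →
          (∀ q ∈ m.primeFactors, IsKolyvaginPrime N W K p q ∧ FrobEqFrobInfty W K (p ^ (M + k)) q) →
          Pt m ∈ KolyvaginCocycle.invPoints (Field.absoluteGaloisGroup K) (A m)
            ((p ^ (M + k) : ℕ) : ℤ) ∧
          (∃ B ∈ A m, hτ.pointsMap W (Pt m) =
            (ε * (-1) ^ m.primeFactors.card) • Pt m + ((p ^ M : ℕ) : ℤ) • B) ∧
          (∀ ℓ : ℕ, ℓ.Prime → ℓ ∣ m → ∀ v : HeightOneSpectrum (𝓞 K), (ℓ : 𝓞 K) ∈ v.asIdeal →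
            ∀ a : ℕ, (((p : ℤ) ^ a) •
                kolyvaginClass (W.baseChange K) _ hdiv (hA m) (Pt m) (hPt m) ∈
                selmerLocalKer (W.baseChange K) (v.adicCompletion K) ((p ^ M : ℕ) : ℤ) ↔
              ((p : ℤ) ^ a) • kolyvaginClass (W.baseChange K) _ hdiv (hA (m / ℓ)) (Pt (m / ℓ))
                  (hPt (m / ℓ)) ∈
                (W.baseChange K).torsionLocalKer (v.adicCompletion K) ((p ^ M : ℕ) : ℤ))))) :
    Nat.card (AddCommGroup.primaryComponent (W.baseChange K).sha p) ≤
      p ^ (2 * padicValNat p (AddSubgroup.zmultiples P).index) := by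
  have hp : p.Prime := Fact.out
  have hndvd : ∀ Q : (W.baseChange K).toAffine.Point, p • Q ≠ P :=
    nsmul_ne_of_padicValNat_index_eq_zero hnt hp hidx0 hidx
  have h0 := sha_primary_eq_zero_of_ringClassRationalPointsM_shift W hN hp hp5 hρ hK ι hin hsp hnt hndvd
    hpointsRk (@fun _ hM _ hℓ _ ↦ kolyvaginReciprocityM_of_poitouTate_of_conductorNorm W hN hPT hp hM hℓ)
  have hbot : AddCommGroup.primaryComponent (W.baseChange K).sha p = ⊥ := by
    refine (AddSubgroup.eq_bot_iff_forall _).mpr fun x hx ↦ ?_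
    obtain ⟨n, hn⟩ := (AddCommGroup.mem_primaryComponent).1 hx
    exact h0 x ⟨n, hn⟩
  rw [hbot, AddSubgroup.card_bot, hidx, mul_zero, pow_zero]

end Summit.BirchSwinnertonDyer.BirchSwinnertonDyer.Theorems

end
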